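import Mathlib.NumberTheory.Padics.PadicNumbers
import Mathlib.Topology.MetricSpace.Contracting
import Mathlib.Analysis.Normed.Group.Ultra
import Mathlib.Tactic.LinearCombination
import Mathlib.Tactic.Abel
import Mathlib.Tactic.FieldSimp
import Mathlib.Tactic.Positivity

/-!
# A two-variable Hensel lemma over `ℚ_p` (chord / simplified Newton method)

Topic `Literature/Analysis/Calculus`; Mathlib-only, everything proved.

**Theorem** (`exists_zero_of_chord`). Let `G : ℚ_p² → ℚ_p²` decompose as
`G(h) = G(0) + L h + Q(h)` with `L = (l₁₁ l₁₂; l₂₁ l₂₂)` having entries of norm `≤ 1` and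
determinant `d ≠ 0`, `δ = |d|_p`, and with a remainder `Q`, `Q(0) = 0`, that is `r`-Lipschitz on
the closed ball of radius `r = δ/p`: `‖Q(h) − Q(h')‖ ≤ r‖h − h'‖` there (as is any polynomial map
without constant and linear terms and with integral coefficients). If `‖G(0)‖ ≤ δ·r = δ²/p` then
`G` has a zero `h` with `‖h‖ ≤ δ⁻¹‖G(0)‖` (`≤ r`).

Proof: the chord map `T(h) = h − L⁻¹G(h) = −L⁻¹(G(0) + Q(h))` maps the (complete) closed ball of
radius `r` into itself and is `1/p`-Lipschitz there (`‖L⁻¹v‖ ≤ δ⁻¹‖v‖`); Banach's fixed point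
theorem (Mathlib `ContractingWith.exists_fixedPoint'`) gives `h` with `L⁻¹G(h) = 0`.

This is the form of Hensel's lemma needed for the *submersion* `(I, J) : V_{ℤ_p} → ℤ_p²` of
binary quartic forms off `Δ = 0` (Bhargava–Shankar, Ann. of Math. 181 (2015), proofs of
Props. 3.7–3.9 of the published version: the invariant map is locally surjective with integral local
sections), where Mathlib only has the one-variable `hensels_lemma`; the instantiation is in
`Literature/NumberTheory/EllipticCurves`.

## References

* Standard (multivariate Hensel / Newton–Kantorovich over complete non-archimedean fields). [folklore]
-/

noncomputable section

open Metric Set Filter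

namespace Literature.Analysis.Calculus

variable {p : ℕ} [Fact p.Prime]

/-- The sup norm on `ℚ_p²` is ultrametric, componentwise. [folklore] -/
theorem norm_add_le_max_prod (u v : ℚ_[p] × ℚ_[p]) : ‖u + v‖ ≤ max ‖u‖ ‖v‖ := by
  rw [Prod.norm_def, Prod.norm_def, Prod.norm_def]
  simp only [Prod.fst_add, Prod.snd_add]
  refine max_le ?_ ?_
  · exact (Padic.nonarchimedean _ _).trans (max_le_max (le_max_left _ _) (le_max_left _ _))
  · exact (Padic.nonarchimedean _ _).trans (max_le_max (le_max_right _ _) (le_max_right _ _))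

/-- A linear form with coefficients of norm `≤ 1` does not increase the sup norm. [folklore] -/
theorem norm_lin_le {a b : ℚ_[p]} (ha : ‖a‖ ≤ 1) (hb : ‖b‖ ≤ 1) (v : ℚ_[p] × ℚ_[p]) :
    ‖a * v.1 + b * v.2‖ ≤ ‖v‖ := by
  refine (Padic.nonarchimedean _ _).trans (max_le ?_ ?_)
  · rw [norm_mul]; exact (mul_le_of_le_one_left (norm_nonneg _) ha).trans (norm_fst_le v)
  · rw [norm_mul]; exact (mul_le_of_le_one_left (norm_nonneg _) hb).trans (norm_snd_le v)

/-- **Two-variable Hensel lemma over `ℚ_p` (chord method).** See the module docstring. [folklore] -/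
theorem exists_zero_of_chord {l₁₁ l₁₂ l₂₁ l₂₂ : ℚ_[p]} (h₁₁ : ‖l₁₁‖ ≤ 1) (h₁₂ : ‖l₁₂‖ ≤ 1)
    (h₂₁ : ‖l₂₁‖ ≤ 1) (h₂₂ : ‖l₂₂‖ ≤ 1) (hd : l₁₁ * l₂₂ - l₁₂ * l₂₁ ≠ 0)
    (G Q : ℚ_[p] × ℚ_[p] → ℚ_[p] × ℚ_[p])
    (hG : ∀ h, G h = G 0 + (l₁₁ * h.1 + l₁₂ * h.2, l₂₁ * h.1 + l₂₂ * h.2) + Q h)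
    (hQ0 : Q 0 = 0)
    (hQ : ∀ h ∈ closedBall (0 : ℚ_[p] × ℚ_[p]) (‖l₁₁ * l₂₂ - l₁₂ * l₂₁‖ / p),
      ∀ h' ∈ closedBall (0 : ℚ_[p] × ℚ_[p]) (‖l₁₁ * l₂₂ - l₁₂ * l₂₁‖ / p),
        ‖Q h - Q h'‖ ≤ ‖l₁₁ * l₂₂ - l₁₂ * l₂₁‖ / p * ‖h - h'‖)
    (hsmall : ‖G 0‖ ≤ ‖l₁₁ * l₂₂ - l₁₂ * l₂₁‖ * (‖l₁₁ * l₂₂ - l₁₂ * l₂₁‖ / p)) :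
    ∃ h : ℚ_[p] × ℚ_[p], G h = 0 ∧ ‖h‖ ≤ ‖l₁₁ * l₂₂ - l₁₂ * l₂₁‖⁻¹ * ‖G 0‖ ∧
      ‖h‖ ≤ ‖l₁₁ * l₂₂ - l₁₂ * l₂₁‖ / p := by
  set d : ℚ_[p] := l₁₁ * l₂₂ - l₁₂ * l₂₁ with hddef
  set δ : ℝ := ‖d‖ with hδ
  have hδpos : 0 < δ := norm_pos_iff.mpr hd
  have hp1 : (1 : ℝ) < p := by exact_mod_cast (Fact.out : p.Prime).one_lt
  have hppos : (0 : ℝ) < p := by linarith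
  set r : ℝ := δ / p with hr
  have hrpos : 0 < r := div_pos hδpos hppos
  have hrδ : r ≤ δ := (div_le_self hδpos.le hp1.le)
  -- the inverse of `L`
  let L : ℚ_[p] × ℚ_[p] → ℚ_[p] × ℚ_[p] := fun h ↦ (l₁₁ * h.1 + l₁₂ * h.2, l₂₁ * h.1 + l₂₂ * h.2)
  let Linv : ℚ_[p] × ℚ_[p] → ℚ_[p] × ℚ_[p] := fun v ↦ (d⁻¹ * (l₂₂ * v.1 - l₁₂ * v.2), d⁻¹ * (-l₂₁ * v.1 + l₁₁ * v.2))
  have hLLinv : ∀ v, L (Linv v) = v := fun v ↦ by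
    ext
    · simp only [L, Linv]; field_simp; ring
    · simp only [L, Linv]; field_simp; ring
  have hLinvL : ∀ h, Linv (L h) = h := fun h ↦ by
    ext
    · simp only [L, Linv]; field_simp; ring
    · simp only [L, Linv]; field_simp; ring
  have hLinv_sub : ∀ v w, Linv v - Linv w = Linv (v - w) := fun v w ↦ by
    ext <;> simp only [Linv, Prod.fst_sub, Prod.snd_sub] <;> ring
  have hLinv_add : ∀ v w, Linv (v + w) = Linv v + Linv w := fun v w ↦ by
    ext <;> simp only [Linv, Prod.fst_add, Prod.snd_add] <;> ring
  have hLinv_norm : ∀ v, ‖Linv v‖ ≤ δ⁻¹ * ‖v‖ := fun v ↦ by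
    rw [Prod.norm_def]
    refine max_le ?_ ?_
    · change ‖d⁻¹ * (l₂₂ * v.1 - l₁₂ * v.2)‖ ≤ _
      rw [norm_mul, norm_inv, sub_eq_add_neg, ← neg_mul]
      exact mul_le_mul_of_nonneg_left (norm_lin_le h₂₂ (by rwa [norm_neg]) v) (inv_nonneg.mpr hδpos.le)
    · change ‖d⁻¹ * (-l₂₁ * v.1 + l₁₁ * v.2)‖ ≤ _
      rw [norm_mul, norm_inv]
      exact mul_le_mul_of_nonneg_left (norm_lin_le (by rwa [norm_neg]) h₁₁ v) (inv_nonneg.mpr hδpos.le)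
  -- the chord map
  let T : ℚ_[p] × ℚ_[p] → ℚ_[p] × ℚ_[p] := fun h ↦ h - Linv (G h)
  have hT : ∀ h, T h = -Linv (G 0 + Q h) := fun h ↦ by
    have hdecomp : G h = (G 0 + Q h) + L h := by rw [hG h]; abel
    show h - Linv (G h) = -Linv (G 0 + Q h)
    rw [hdecomp, hLinv_add, hLinvL]
    abel
  -- `Q` is small on the ball
  have hQsmall : ∀ h ∈ closedBall (0 : ℚ_[p] × ℚ_[p]) r, ‖Q h‖ ≤ r * ‖h‖ := fun h hh ↦ by
    have := hQ h hh 0 (mem_closedBall_self hrpos.le)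
    rwa [hQ0, sub_zero, sub_zero] at this
  -- `T` maps the ball into itself
  have hmaps : MapsTo T (closedBall 0 r) (closedBall 0 r) := fun h hh ↦ by
    have hh' : ‖h‖ ≤ r := by simpa [mem_closedBall, dist_zero_right] using hh
    rw [mem_closedBall, dist_zero_right, hT, norm_neg]
    refine (hLinv_norm _).trans ?_
    have h1 : ‖G 0 + Q h‖ ≤ max ‖G 0‖ ‖Q h‖ := norm_add_le_max_prod _ _
    have h2 : ‖Q h‖ ≤ r * r := (hQsmall h hh).trans (mul_le_mul_of_nonneg_left hh' hrpos.le)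
    have h3 : max ‖G 0‖ ‖Q h‖ ≤ δ * r := max_le hsmall (h2.trans (mul_le_mul_of_nonneg_right hrδ hrpos.le))
    calc δ⁻¹ * ‖G 0 + Q h‖ ≤ δ⁻¹ * (δ * r) := mul_le_mul_of_nonneg_left (h1.trans h3) (inv_nonneg.mpr hδpos.le)
      _ = r := by field_simp
  -- and contracts there, with constant `1/p`
  set K : NNReal := ⟨(p : ℝ)⁻¹, inv_nonneg.mpr hppos.le⟩ with hK
  have hK1 : K < 1 := by
    change (p : ℝ)⁻¹ < 1
    exact inv_lt_one_of_one_lt₀ hp1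
  have hlip : LipschitzOnWith K T (closedBall 0 r) := by
    refine LipschitzOnWith.of_dist_le_mul fun h hh h' hh' ↦ ?_
    rw [dist_eq_norm, dist_eq_norm, hT, hT, neg_sub_neg, hLinv_sub]
    have h1 : G 0 + Q h' - (G 0 + Q h) = Q h' - Q h := by abel
    rw [h1]
    refine (hLinv_norm _).trans ?_
    have h2 := hQ h' hh' h hh
    change δ⁻¹ * ‖Q h' - Q h‖ ≤ (p : ℝ)⁻¹ * ‖h - h'‖
    rw [norm_sub_rev h h']
    calc δ⁻¹ * ‖Q h' - Q h‖ ≤ δ⁻¹ * (r * ‖h' - h‖) := mul_le_mul_of_nonneg_left h2 (inv_nonneg.mpr hδpos.le)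
      _ = (p : ℝ)⁻¹ * ‖h' - h‖ := by rw [hr]; field_simp
  have hcontr : ContractingWith K (hmaps.restrict T (closedBall 0 r) (closedBall 0 r)) :=
    ⟨hK1, (hmaps.lipschitzOnWith_iff_restrict).mp hlip⟩
  have hcomplete : IsComplete (closedBall (0 : ℚ_[p] × ℚ_[p]) r) := isClosed_closedBall.isComplete
  obtain ⟨h, hhmem, hfix, -⟩ := hcontr.exists_fixedPoint' hcomplete hmaps (mem_closedBall_self hrpos.le)
    (edist_ne_top _ _)
  have hh' : ‖h‖ ≤ r := by simpa [mem_closedBall, dist_zero_right] using hhmem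
  -- the fixed point is a zero of `G`
  have hGh : G h = 0 := by
    have h1 : Linv (G h) = 0 := by
      have : h - Linv (G h) = h := hfix
      have h2 : Linv (G h) = h - (h - Linv (G h)) := by abel
      rw [h2, this, sub_self]
    rw [← hLLinv (G h), h1]
    ext <;> simp [L]
  refine ⟨h, hGh, ?_, hh'⟩
  -- the bound `‖h‖ ≤ δ⁻¹ ‖G 0‖`
  have heq : h = -Linv (G 0 + Q h) := by rw [← hT h]; exact hfix.symm
  have hbound : ‖h‖ ≤ δ⁻¹ * max ‖G 0‖ ‖Q h‖ := by
    conv_lhs => rw [heq]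
    rw [norm_neg]
    exact (hLinv_norm _).trans (mul_le_mul_of_nonneg_left (norm_add_le_max_prod _ _) (inv_nonneg.mpr hδpos.le))
  rcases le_total ‖Q h‖ ‖G 0‖ with hle | hle
  · rw [max_eq_left hle] at hbound; exact hbound
  · rw [max_eq_right hle] at hbound
    -- then `‖h‖ ≤ ‖h‖/p`, so `h = 0`
    have h1 : ‖h‖ ≤ (p : ℝ)⁻¹ * ‖h‖ := by
      calc ‖h‖ ≤ δ⁻¹ * ‖Q h‖ := hbound
        _ ≤ δ⁻¹ * (r * ‖h‖) := mul_le_mul_of_nonneg_left (hQsmall h hhmem) (inv_nonneg.mpr hδpos.le)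
        _ = (p : ℝ)⁻¹ * ‖h‖ := by rw [hr]; field_simp
    have h2 : ‖h‖ = 0 := by
      by_contra hne
      have hpos : 0 < ‖h‖ := lt_of_le_of_ne (norm_nonneg _) (Ne.symm hne)
      have : (1 : ℝ) ≤ (p : ℝ)⁻¹ := by
        have := div_le_div_of_nonneg_right h1 hpos.le
        rwa [div_self hpos.ne', mul_div_assoc, div_self hpos.ne', mul_one] at this
      exact absurd (this.trans_lt (inv_lt_one_of_one_lt₀ hp1)) (lt_irrefl _)
    rw [h2]
    positivity

end Literature.Analysis.Calculus

end
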